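import Literature.Analysis.Fourier.QuarterWaveParseval

/-!
# The Dirichlet–Neumann form `‖φ″‖² − (5π²/2)‖φ′‖² + (9π⁴/16)‖φ‖²` on `[0,1]`: diagonalisation, positivity, kernel

Topic `Literature/NumberTheory/LFunctions`, grouping with the other `Zhang2022/*` files (autopsy of
Y. Zhang, *Discrete mean estimates and the Landau–Siegel zero*, arXiv:2211.02515 (2022)
[Zhang2022LandauSiegel]). This file is pure real analysis and makes NO claim about that manuscript's
theorems; it is the analytic heart of the repair cell's structural theorem "the glued main-term
form `𝔅` of the `(A)`-world mean value is positive semidefinite with a three-dimensional kernel"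
(PROOF-O15, (T2)–(T4)), whose remaining, purely computational layers (demodulation
`𝔅(g,g) = (8/π)·Q̃(R)` and the removal of the boundary terms of `Q̃` along the radical direction
`cos(πy/2) − cos(3πy/2)`) are the business of the companion file `MainTermFormPSD.lean`.

For `φ ∈ C²[0,1]` (`IsC2OnUnitInterval φ φ' φ''`: `φ, φ′, φ″` continuous on `[0,1]`, derivatives
in the open interval) with the mixed boundary conditions `φ(0) = 0`, `φ′(1) = 0`, put
`Q(φ) = dnForm φ φ' φ'' = ∫₀¹‖φ″‖² − (5π²/2)∫₀¹‖φ′‖² + (9π⁴/16)∫₀¹‖φ‖²` and let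
`c_k = qwCoeff φ k = ∫₀¹ φ · √2 sin((k+½)π·)` be the quarter-wave sine coefficients. Then

* `dnForm_hasSum` : `Q(φ) = ∑_{k ≥ 0} π⁴ (k−1)k(k+1)(k+2) |c_k|²` (`HasSum`; weights `dnWeight k`);
* `dnForm_nonneg` : `Q(φ) ≥ 0`;
* `sum_sq_qwCoeff_le_dnForm` : `24π⁴ ∑_{k ∈ s} |c_k|² ≤ Q(φ)` for any finite set `s` of indices `≥ 2`
  (the spectral gap `24π⁴` above the kernel);
* `dnForm_eq_zero_iff` : `Q(φ) = 0 ↔ c_k = 0` for all `k ≥ 2` (the kernel is spanned, in `L²`, by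
  the two lowest modes `sin(πx/2)`, `sin(3πx/2)`: the symbol
  `ν² − (5π²/2)ν + 9π⁴/16 = (ν − π²/4)(ν − 9π²/4)` vanishes exactly at `ν₀ = π²/4`, `ν₁ = 9π²/4`).

Method (Bessel-free, one idea): with `a = 5π²/4` and `ψ = φ″ + aφ`,
(i) `∫‖ψ‖² = ∫‖φ″‖² − 2a∫‖φ′‖² + a²∫‖φ‖²` (`integral_norm_sq_dd_add_mul`; one integration by parts,
the boundary term `[φ′φ̄]₀¹` dies by the two boundary conditions), so `Q(φ) = ‖ψ‖² − π⁴‖φ‖²`;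
(ii) `c_k(φ″) = −ν_k c_k(φ)`, `ν_k = (k+½)²π²` (`qwCoeff_dd`; two integrations by parts against the
mode, boundary terms die by `e_k(0) = 0`, `e_k′(1) = 0`, `φ(0) = 0`, `φ′(1) = 0`), so
`c_k(ψ) = (a − ν_k)c_k(φ)`;
(iii) Parseval (`Literature.Analysis.Fourier.hasSum_sq_qwCoeff_of_continuousOn`) for `ψ` and `φ`,
and the identity `(a − ν_k)² − π⁴ = π⁴(k−1)k(k+1)(k+2)`.

Sources: the statement is the repair cell's (pub-zhang, 2026-08) reading of the main-term form;
the mathematics is standard Sturm–Liouville / Fourier analysis, tagged [folklore]. NOT here: the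
`H²` (rather than `C²`) version, the form with boundary terms, and anything about `𝔅` itself.
-/

noncomputable section

open MeasureTheory Set intervalIntegral
open scoped Real

namespace Literature.NumberTheory.LFunctions.Zhang2022

open Literature.Analysis.Fourier

/-- `φ ∈ C²[0,1]` with first and second derivatives `φ'`, `φ''` (as functions on `ℝ`; only their
values on `[0,1]` matter): all three continuous on `[0,1]`, and `φ' = dφ/dx`, `φ'' = dφ'/dx` on the
open interval. [folklore] -/
structure IsC2OnUnitInterval (φ φ' φ'' : ℝ → ℂ) : Prop where
  cont : ContinuousOn φ (Icc 0 1)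
  cont' : ContinuousOn φ' (Icc 0 1)
  cont'' : ContinuousOn φ'' (Icc 0 1)
  hasDeriv : ∀ x ∈ Ioo (0:ℝ) 1, HasDerivAt φ (φ' x) x
  hasDeriv' : ∀ x ∈ Ioo (0:ℝ) 1, HasDerivAt φ' (φ'' x) x

/-- The Dirichlet–Neumann form `Q(φ) = ‖φ″‖² - (5π²/2)‖φ′‖² + (9π⁴/16)‖φ‖²` (norms in `L²(0,1)`),
the bulk part of the demodulated main-term form `Q̃` of [Zhang2022LandauSiegel] as analysed in the
repair cell (PROOF-O15 (T1)); its symbol `ν² - (5π²/2)ν + 9π⁴/16 = (ν - π²/4)(ν - 9π²/4)` vanishes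
exactly at the two lowest Dirichlet–Neumann eigenvalues `ν₀ = π²/4`, `ν₁ = 9π²/4`. [folklore] -/
def dnForm (φ φ' φ'' : ℝ → ℂ) : ℝ :=
  (∫ x in (0:ℝ)..1, ‖φ'' x‖ ^ 2) - 5 * π ^ 2 / 2 * (∫ x in (0:ℝ)..1, ‖φ' x‖ ^ 2)
    + 9 * π ^ 4 / 16 * ∫ x in (0:ℝ)..1, ‖φ x‖ ^ 2

variable {φ φ' φ'' : ℝ → ℂ}

/-- Integration by parts on `[0,1]` in product-rule form:
`∫₀¹ (u′v + uv′) = u(1)v(1) - u(0)v(0)` for `u, v ∈ C¹[0,1]`. [folklore] -/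
theorem integral_deriv_mul_unitInterval {u v u' v' : ℝ → ℂ} (hu : ContinuousOn u (Icc 0 1))
    (hv : ContinuousOn v (Icc 0 1)) (huu' : ∀ x ∈ Ioo (0:ℝ) 1, HasDerivAt u (u' x) x)
    (hvv' : ∀ x ∈ Ioo (0:ℝ) 1, HasDerivAt v (v' x) x) (hu' : IntervalIntegrable u' volume 0 1)
    (hv' : IntervalIntegrable v' volume 0 1) :
    ∫ x in (0:ℝ)..1, (u' x * v x + u x * v' x) = u 1 * v 1 - u 0 * v 0 := by
  refine integral_deriv_mul_eq_sub_of_hasDerivAt ?_ ?_ ?_ ?_ hu' hv'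
  · rwa [uIcc_of_le zero_le_one]
  · rwa [uIcc_of_le zero_le_one]
  · simpa only [min_eq_left zero_le_one, max_eq_right zero_le_one] using huu'
  · simpa only [min_eq_left zero_le_one, max_eq_right zero_le_one] using hvv'

/-- `∫₀¹ h · conj h = ∫₀¹ ‖h‖²` (as a complex number). [folklore] -/
theorem integral_mul_conj_eq_ofReal (h : ℝ → ℂ) :
    ∫ x in (0:ℝ)..1, h x * starRingEnd ℂ (h x) = ((∫ x in (0:ℝ)..1, ‖h x‖ ^ 2 : ℝ) : ℂ) := by
  rw [← intervalIntegral.integral_ofReal]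
  refine intervalIntegral.integral_congr fun x _ => ?_
  simp only [Complex.mul_conj']
  norm_cast

/-- `x ↦ conj (h x)` is continuous on `s` if `h` is. [folklore] -/
theorem continuousOn_conj_comp {h : ℝ → ℂ} {s : Set ℝ} (hh : ContinuousOn h s) :
    ContinuousOn (fun x => starRingEnd ℂ (h x)) s :=
  Complex.continuous_conj.comp_continuousOn hh

/-- `(conj ∘ h)′ = conj h′`. [folklore] -/
theorem hasDerivAt_conj_comp {h : ℝ → ℂ} {h' : ℂ} {x : ℝ} (hh : HasDerivAt h h' x) :
    HasDerivAt (fun x => starRingEnd ℂ (h x)) (starRingEnd ℂ h') x := by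
  simpa using hh.star

/-- First by-parts identity under the boundary conditions `φ(0) = 0`, `φ′(1) = 0`:
`∫₀¹ (φ″ φ̄ + φ′ φ̄′) = 0`. [folklore] -/
theorem integral_dd_mul_conj_add (hφ : IsC2OnUnitInterval φ φ' φ'') (h0 : φ 0 = 0)
    (h1 : φ' 1 = 0) :
    ∫ x in (0:ℝ)..1, (φ'' x * starRingEnd ℂ (φ x) + φ' x * starRingEnd ℂ (φ' x)) = 0 := by
  have h := integral_deriv_mul_unitInterval hφ.cont' (continuousOn_conj_comp hφ.cont) hφ.hasDeriv'
    (fun x hx => hasDerivAt_conj_comp (hφ.hasDeriv x hx))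
    (hφ.cont''.intervalIntegrable_of_Icc zero_le_one)
    ((continuousOn_conj_comp hφ.cont').intervalIntegrable_of_Icc zero_le_one)
  rw [h, h0, h1]
  simp

/-- The conjugate identity `∫₀¹ (φ̄″ φ + φ̄′ φ′) = 0`. [folklore] -/
theorem integral_conj_dd_mul_add (hφ : IsC2OnUnitInterval φ φ' φ'') (h0 : φ 0 = 0)
    (h1 : φ' 1 = 0) :
    ∫ x in (0:ℝ)..1, (starRingEnd ℂ (φ'' x) * φ x + starRingEnd ℂ (φ' x) * φ' x) = 0 := by
  have h := integral_deriv_mul_unitInterval (continuousOn_conj_comp hφ.cont') hφ.cont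
    (fun x hx => hasDerivAt_conj_comp (hφ.hasDeriv' x hx)) hφ.hasDeriv
    ((continuousOn_conj_comp hφ.cont'').intervalIntegrable_of_Icc zero_le_one)
    (hφ.cont'.intervalIntegrable_of_Icc zero_le_one)
  rw [h, h0, h1]
  simp

/-- Expansion of `‖φ″ + aφ‖²` in `L²(0,1)` under `φ(0) = 0`, `φ′(1) = 0` (`a` real):
`∫₀¹ ‖φ″ + aφ‖² = ∫‖φ″‖² - 2a ∫‖φ′‖² + a² ∫‖φ‖²` (one integration by parts:
`Re ∫ φ″φ̄ = -∫‖φ′‖²`). [folklore] -/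
theorem integral_norm_sq_dd_add_mul (hφ : IsC2OnUnitInterval φ φ' φ'') (h0 : φ 0 = 0)
    (h1 : φ' 1 = 0) (a : ℝ) :
    ∫ x in (0:ℝ)..1, ‖φ'' x + a * φ x‖ ^ 2 =
      (∫ x in (0:ℝ)..1, ‖φ'' x‖ ^ 2) - 2 * a * (∫ x in (0:ℝ)..1, ‖φ' x‖ ^ 2)
        + a ^ 2 * ∫ x in (0:ℝ)..1, ‖φ x‖ ^ 2 := by
  have hI : ∀ {h : ℝ → ℂ}, ContinuousOn h (Icc 0 1) → IntervalIntegrable h volume 0 1 :=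
    fun hh => hh.intervalIntegrable_of_Icc zero_le_one
  have cφ := hφ.cont
  have cφ' := hφ.cont'
  have cφ'' := hφ.cont''
  have ccφ := continuousOn_conj_comp hφ.cont
  have ccφ' := continuousOn_conj_comp hφ.cont'
  have ccφ'' := continuousOn_conj_comp hφ.cont''
  have cψ : ContinuousOn (fun x => φ'' x + (a : ℂ) * φ x) (Icc 0 1) :=
    cφ''.add (continuousOn_const.mul cφ)
  apply Complex.ofReal_injective
  push_cast
  rw [← integral_mul_conj_eq_ofReal, ← integral_mul_conj_eq_ofReal, ← integral_mul_conj_eq_ofReal,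
    ← integral_mul_conj_eq_ofReal]
  -- pointwise expansion of the integrand
  have hpt : ∀ x, (φ'' x + a * φ x) * starRingEnd ℂ (φ'' x + a * φ x) =
      φ'' x * starRingEnd ℂ (φ'' x)
        + (a : ℂ) * ((φ'' x * starRingEnd ℂ (φ x) + φ' x * starRingEnd ℂ (φ' x))
            + (starRingEnd ℂ (φ'' x) * φ x + starRingEnd ℂ (φ' x) * φ' x))
        - 2 * (a : ℂ) * (φ' x * starRingEnd ℂ (φ' x))
        + (a : ℂ) ^ 2 * (φ x * starRingEnd ℂ (φ x)) := by
    intro x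
    simp only [map_add, map_mul, Complex.conj_ofReal]
    ring
  simp_rw [hpt]
  have i1 : IntervalIntegrable (fun x => φ'' x * starRingEnd ℂ (φ'' x)) volume 0 1 := hI (cφ''.mul ccφ'')
  have i2 : IntervalIntegrable (fun x => φ'' x * starRingEnd ℂ (φ x) + φ' x * starRingEnd ℂ (φ' x))
      volume 0 1 := hI ((cφ''.mul ccφ).add (cφ'.mul ccφ'))
  have i3 : IntervalIntegrable (fun x => starRingEnd ℂ (φ'' x) * φ x + starRingEnd ℂ (φ' x) * φ' x)
      volume 0 1 := hI ((ccφ''.mul cφ).add (ccφ'.mul cφ'))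
  have i4 : IntervalIntegrable (fun x => φ' x * starRingEnd ℂ (φ' x)) volume 0 1 := hI (cφ'.mul ccφ')
  have i5 : IntervalIntegrable (fun x => φ x * starRingEnd ℂ (φ x)) volume 0 1 := hI (cφ.mul ccφ)
  have i23 := (i2.add i3).const_mul (a : ℂ)
  have i4' := i4.const_mul (2 * (a : ℂ))
  have i5' := i5.const_mul ((a : ℂ) ^ 2)
  rw [intervalIntegral.integral_add ((i1.add i23).sub i4') i5',
    intervalIntegral.integral_sub (i1.add i23) i4', intervalIntegral.integral_add i1 i23,
    intervalIntegral.integral_const_mul, intervalIntegral.integral_const_mul,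
    intervalIntegral.integral_const_mul, intervalIntegral.integral_add i2 i3,
    integral_dd_mul_conj_add hφ h0 h1, integral_conj_dd_mul_add hφ h0 h1]
  ring


/-! ### The coefficients of `φ″` -/

/-- The complexified mode `x ↦ (e_k(x) : ℂ)` has derivative `(e_k′(x) : ℂ)`. [folklore] -/
theorem hasDerivAt_qwSin_ofReal (k : ℕ) (x : ℝ) :
    HasDerivAt (fun y => ((qwSin k y : ℝ) : ℂ))
      (((√2 * (qwFreq k * Real.cos (qwFreq k * x)) : ℝ) : ℂ)) x :=
  (hasDerivAt_qwSin k x).ofReal_comp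

/-- The complexified `e_k′` has derivative `(-ν_k e_k(x) : ℂ)`. [folklore] -/
theorem hasDerivAt_deriv_qwSin_ofReal (k : ℕ) (x : ℝ) :
    HasDerivAt (fun y => ((√2 * (qwFreq k * Real.cos (qwFreq k * y)) : ℝ) : ℂ))
      (((-(qwFreq k ^ 2) * qwSin k x : ℝ) : ℂ)) x :=
  (hasDerivAt_deriv_qwSin k x).ofReal_comp

/-- `c_k(φ″) = -ν_k c_k(φ)` for `φ ∈ C²[0,1]` with `φ(0) = 0`, `φ′(1) = 0` (two integrations by
parts; the boundary terms vanish because `e_k(0) = 0` and `e_k′(1) = 0`). [folklore] -/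
theorem qwCoeff_dd (hφ : IsC2OnUnitInterval φ φ' φ'') (h0 : φ 0 = 0) (h1 : φ' 1 = 0) (k : ℕ) :
    qwCoeff φ'' k = -((qwFreq k ^ 2 : ℝ) : ℂ) * qwCoeff φ k := by
  have cE : Continuous (fun y => ((qwSin k y : ℝ) : ℂ)) := by
    simp only [qwSin]; fun_prop
  have cE' : Continuous (fun y => ((√2 * (qwFreq k * Real.cos (qwFreq k * y)) : ℝ) : ℂ)) := by
    fun_prop
  have cE'' : Continuous (fun y => ((-(qwFreq k ^ 2) * qwSin k y : ℝ) : ℂ)) := by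
    simp only [qwSin]; fun_prop
  have hI : ∀ {h : ℝ → ℂ}, ContinuousOn h (Icc 0 1) → IntervalIntegrable h volume 0 1 :=
    fun hh => hh.intervalIntegrable_of_Icc zero_le_one
  have iA : IntervalIntegrable (fun x => φ'' x * ((qwSin k x : ℝ) : ℂ)) volume 0 1 :=
    hI (hφ.cont''.mul cE.continuousOn)
  have iB : IntervalIntegrable
      (fun x => φ' x * ((√2 * (qwFreq k * Real.cos (qwFreq k * x)) : ℝ) : ℂ)) volume 0 1 :=
    hI (hφ.cont'.mul cE'.continuousOn)
  have iC : IntervalIntegrable (fun x => φ x * ((-(qwFreq k ^ 2) * qwSin k x : ℝ) : ℂ))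
      volume 0 1 :=
    hI (hφ.cont.mul cE''.continuousOn)
  -- first integration by parts: u = φ', v = e_k
  have bp1 := integral_deriv_mul_unitInterval hφ.cont' cE.continuousOn hφ.hasDeriv'
    (fun x _ => hasDerivAt_qwSin_ofReal k x) (hI hφ.cont'') (cE'.intervalIntegrable 0 1)
  have hb1 : φ' 1 * ((qwSin k 1 : ℝ) : ℂ) - φ' 0 * ((qwSin k 0 : ℝ) : ℂ) = 0 := by
    rw [h1, qwSin_zero]; simp
  rw [hb1, intervalIntegral.integral_add iA iB] at bp1
  -- second integration by parts: u = φ, v = e_k′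
  have bp2 := integral_deriv_mul_unitInterval hφ.cont cE'.continuousOn hφ.hasDeriv
    (fun x _ => hasDerivAt_deriv_qwSin_ofReal k x) (hI hφ.cont') (cE''.intervalIntegrable 0 1)
  have hb2 : φ 1 * ((√2 * (qwFreq k * Real.cos (qwFreq k * 1)) : ℝ) : ℂ)
      - φ 0 * ((√2 * (qwFreq k * Real.cos (qwFreq k * 0)) : ℝ) : ℂ) = 0 := by
    rw [h0, mul_one, cos_qwFreq]; simp
  rw [hb2, intervalIntegral.integral_add iB iC] at bp2
  have C : ∫ x in (0:ℝ)..1, φ x * ((-(qwFreq k ^ 2) * qwSin k x : ℝ) : ℂ) =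
      -((qwFreq k ^ 2 : ℝ) : ℂ) * qwCoeff φ k := by
    rw [qwCoeff, ← intervalIntegral.integral_const_mul]
    refine intervalIntegral.integral_congr fun x _ => ?_
    push_cast
    ring
  rw [qwCoeff]
  linear_combination bp1 - bp2 + C

/-- `c_k(φ″ + aφ) = (a - ν_k) c_k(φ)` under the same hypotheses. [folklore] -/
theorem qwCoeff_dd_add_mul (hφ : IsC2OnUnitInterval φ φ' φ'') (h0 : φ 0 = 0) (h1 : φ' 1 = 0)
    (a : ℝ) (k : ℕ) :
    qwCoeff (fun x => φ'' x + a * φ x) k = ((a - qwFreq k ^ 2 : ℝ) : ℂ) * qwCoeff φ k := by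
  have cE : Continuous (fun y => ((qwSin k y : ℝ) : ℂ)) := by simp only [qwSin]; fun_prop
  have i1 : IntervalIntegrable (fun x => φ'' x * ((qwSin k x : ℝ) : ℂ)) volume 0 1 :=
    (hφ.cont''.mul cE.continuousOn).intervalIntegrable_of_Icc zero_le_one
  have i2 : IntervalIntegrable (fun x => (a : ℂ) * (φ x * ((qwSin k x : ℝ) : ℂ))) volume 0 1 :=
    ((hφ.cont.mul cE.continuousOn).intervalIntegrable_of_Icc zero_le_one).const_mul _
  have e : qwCoeff (fun x => φ'' x + a * φ x) k = qwCoeff φ'' k + (a : ℂ) * qwCoeff φ k := by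
    rw [qwCoeff, qwCoeff, qwCoeff, ← intervalIntegral.integral_const_mul,
      ← intervalIntegral.integral_add i1 i2]
    refine intervalIntegral.integral_congr fun x _ => ?_
    ring
  rw [e, qwCoeff_dd hφ h0 h1]
  push_cast
  ring

/-! ### Diagonalisation and positivity of the Dirichlet–Neumann form -/

/-- The weight `w_k = π⁴ (k-1)k(k+1)(k+2)` of the diagonalised form. [folklore] -/
def dnWeight (k : ℕ) : ℝ := π ^ 4 * (((k : ℝ) - 1) * k * (k + 1) * (k + 2))

/-- `w_k ≥ 0` (it vanishes at `k = 0, 1`). [folklore] -/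
theorem dnWeight_nonneg (k : ℕ) : 0 ≤ dnWeight k := by
  unfold dnWeight
  rcases k with _ | n
  · simp
  · push_cast
    have : ((n : ℝ) + 1 - 1) = n := by ring
    rw [this]
    positivity

/-- `w_k ≥ 24π⁴ > 0` for `k ≥ 2`. [folklore] -/
theorem dnWeight_ge (k : ℕ) (hk : 2 ≤ k) : 24 * π ^ 4 ≤ dnWeight k := by
  unfold dnWeight
  obtain ⟨n, rfl⟩ := Nat.exists_eq_add_of_le hk
  push_cast
  have hn : (0:ℝ) ≤ n := n.cast_nonneg
  have hπ : 0 < π ^ 4 := by positivity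
  nlinarith [mul_nonneg hn hn, mul_nonneg (mul_nonneg hn hn) hn, mul_nonneg (mul_nonneg (mul_nonneg hn hn) hn) hn,
    mul_le_mul_of_nonneg_left (show (24:ℝ) ≤ (2 + n - 1) * (2 + n) * (2 + n + 1) * (2 + n + 2) by nlinarith [mul_nonneg hn hn, mul_nonneg (mul_nonneg hn hn) hn, mul_nonneg (mul_nonneg (mul_nonneg hn hn) hn) hn]) hπ.le]

/-- `w_k > 0` for `k ≥ 2`. [folklore] -/
theorem dnWeight_pos (k : ℕ) (hk : 2 ≤ k) : 0 < dnWeight k :=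
  lt_of_lt_of_le (by positivity) (dnWeight_ge k hk)

/-- **Diagonalisation of the Dirichlet–Neumann form.** For `φ ∈ C²[0,1]` with `φ(0) = 0`,
`φ′(1) = 0` and `c_k = c_k(φ)` its quarter-wave sine coefficients,
`‖φ″‖² - (5π²/2)‖φ′‖² + (9π⁴/16)‖φ‖² = ∑_{k ≥ 0} π⁴(k-1)k(k+1)(k+2) |c_k|²` (absolutely convergent).
Proof: with `ψ = φ″ + (5π²/4)φ`, `Q(φ) = ‖ψ‖² - π⁴‖φ‖²` (`integral_norm_sq_dd_add_mul`),
`c_k(ψ) = (5π²/4 - ν_k)c_k(φ)` (`qwCoeff_dd_add_mul`), Parseval for `ψ` and `φ`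
(`hasSum_sq_qwCoeff_of_continuousOn`), and `(5π²/4 - ν_k)² - π⁴ = π⁴(k-1)k(k+1)(k+2)` for
`ν_k = (k+½)²π²`. This is (T2) of the repair cell's PROOF-O15 for the bulk form. [folklore] -/
theorem dnForm_hasSum (hφ : IsC2OnUnitInterval φ φ' φ'') (h0 : φ 0 = 0) (h1 : φ' 1 = 0) :
    HasSum (fun k : ℕ => dnWeight k * ‖qwCoeff φ k‖ ^ 2) (dnForm φ φ' φ'') := by
  set a : ℝ := 5 * π ^ 2 / 4 with ha
  have hψc : ContinuousOn (fun x => φ'' x + (a : ℂ) * φ x) (Icc 0 1) :=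
    hφ.cont''.add (continuousOn_const.mul hφ.cont)
  have Pψ := hasSum_sq_qwCoeff_of_continuousOn hψc
  have Pφ := hasSum_sq_qwCoeff_of_continuousOn hφ.cont
  have hcoef : ∀ k, ‖qwCoeff (fun x => φ'' x + (a : ℂ) * φ x) k‖ ^ 2 =
      (a - qwFreq k ^ 2) ^ 2 * ‖qwCoeff φ k‖ ^ 2 := by
    intro k
    rw [qwCoeff_dd_add_mul hφ h0 h1 a k, norm_mul, mul_pow, Complex.norm_real, Real.norm_eq_abs,
      sq_abs]
  simp_rw [hcoef] at Pψ
  rw [integral_norm_sq_dd_add_mul hφ h0 h1 a] at Pψ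
  have key := Pψ.sub (Pφ.mul_left (π ^ 4))
  have e1 : (fun k : ℕ => dnWeight k * ‖qwCoeff φ k‖ ^ 2) =
      fun k : ℕ => (a - qwFreq k ^ 2) ^ 2 * ‖qwCoeff φ k‖ ^ 2 - π ^ 4 * ‖qwCoeff φ k‖ ^ 2 := by
    funext k
    simp only [dnWeight, qwFreq, ha]
    ring
  have e2 : dnForm φ φ' φ'' =
      (∫ x in (0:ℝ)..1, ‖φ'' x‖ ^ 2) - 2 * a * (∫ x in (0:ℝ)..1, ‖φ' x‖ ^ 2)
        + a ^ 2 * (∫ x in (0:ℝ)..1, ‖φ x‖ ^ 2) - π ^ 4 * ∫ x in (0:ℝ)..1, ‖φ x‖ ^ 2 := by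
    simp only [dnForm, ha]
    ring
  rw [e1, e2]
  exact key

/-- **The Dirichlet–Neumann form is positive semidefinite** on
`{φ ∈ C²[0,1] : φ(0) = 0, φ′(1) = 0}`. [folklore] -/
theorem dnForm_nonneg (hφ : IsC2OnUnitInterval φ φ' φ'') (h0 : φ 0 = 0) (h1 : φ' 1 = 0) :
    0 ≤ dnForm φ φ' φ'' :=
  (dnForm_hasSum hφ h0 h1).nonneg fun k => mul_nonneg (dnWeight_nonneg k) (sq_nonneg _)

/-- The spectral-gap form of positivity ((T3) of PROOF-O15 for the bulk form):
`Q(φ) ≥ 24π⁴ ∑_{k ≥ 2} |c_k(φ)|²`, stated as: for every finite set `s` of indices `≥ 2`,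
`24π⁴ ∑_{k ∈ s} |c_k|² ≤ Q(φ)`. [folklore] -/
theorem sum_sq_qwCoeff_le_dnForm (hφ : IsC2OnUnitInterval φ φ' φ'') (h0 : φ 0 = 0)
    (h1 : φ' 1 = 0) (s : Finset ℕ) (hs : ∀ k ∈ s, 2 ≤ k) :
    24 * π ^ 4 * ∑ k ∈ s, ‖qwCoeff φ k‖ ^ 2 ≤ dnForm φ φ' φ'' := by
  have h := dnForm_hasSum hφ h0 h1
  calc 24 * π ^ 4 * ∑ k ∈ s, ‖qwCoeff φ k‖ ^ 2
      = ∑ k ∈ s, 24 * π ^ 4 * ‖qwCoeff φ k‖ ^ 2 := by rw [Finset.mul_sum]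
    _ ≤ ∑ k ∈ s, dnWeight k * ‖qwCoeff φ k‖ ^ 2 :=
        Finset.sum_le_sum fun k hk => mul_le_mul_of_nonneg_right (dnWeight_ge k (hs k hk)) (sq_nonneg _)
    _ ≤ dnForm φ φ' φ'' :=
        sum_le_hasSum s (fun k _ => mul_nonneg (dnWeight_nonneg k) (sq_nonneg _)) h

/-- **Kernel of the Dirichlet–Neumann form** ((T4) of PROOF-O15 for the bulk form): `Q(φ) = 0`
iff all quarter-wave coefficients `c_k(φ)` with `k ≥ 2` vanish, i.e. iff `φ` is `L²`-spanned by
`e₀ = √2 sin(πx/2)` and `e₁ = √2 sin(3πx/2)`. [folklore] -/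
theorem dnForm_eq_zero_iff (hφ : IsC2OnUnitInterval φ φ' φ'') (h0 : φ 0 = 0) (h1 : φ' 1 = 0) :
    dnForm φ φ' φ'' = 0 ↔ ∀ k : ℕ, 2 ≤ k → qwCoeff φ k = 0 := by
  have h := dnForm_hasSum hφ h0 h1
  have hnn : ∀ k, 0 ≤ dnWeight k * ‖qwCoeff φ k‖ ^ 2 :=
    fun k => mul_nonneg (dnWeight_nonneg k) (sq_nonneg _)
  constructor
  · intro hz k hk
    rw [hz] at h
    have hfk := congr_fun ((hasSum_zero_iff_of_nonneg hnn).mp h) k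
    simp only [Pi.zero_apply, mul_eq_zero] at hfk
    rcases hfk with hw | hc
    · exact absurd hw (dnWeight_pos k hk).ne'
    · exact norm_eq_zero.mp (pow_eq_zero_iff two_ne_zero |>.mp hc)
  · intro hc
    have hf : (fun k : ℕ => dnWeight k * ‖qwCoeff φ k‖ ^ 2) = 0 := by
      funext k
      simp only [Pi.zero_apply]
      rcases Nat.lt_or_ge k 2 with hk | hk
      · interval_cases k <;> simp [dnWeight]
      · simp [hc k hk]
    rw [hf] at h
    exact h.unique hasSum_zero

end Literature.NumberTheory.LFunctions.Zhang2022
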